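import Summits.RiemannHypothesis.RiemannHypothesis.Theorems.SigmaLNoViolation
import Summits.RiemannHypothesis.RiemannHypothesis.Theorems.SigmaLOnLineW0
import HarnessLib

/-!
# SigmaL / BC5 rung W0 — **THE RUNG `SigmaL_rung_W0`**: Σ_L on the window `(H₀ + 20, H₀ + 30)` above the
# Platt–Trudgian height `H₀ = 3 000 175 332 800` (PROVED modulo the certified computation; RH is NOT proved)

Route `RiemannHypothesis/HardyZLehmerSplit`, item `SigmaL` (stmt-RiemannHypothesis-24253), tribunal seat
`rh-trib-w-sigmaL-1` (bc5-witness planner; registered stub `SigmaL_rung_W0`). NOTHING HERE PROVES OR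
ASSUMES RH: the rung is a decidable instance of Σ_L OUTSIDE RH's verified range, from the certified-computation
theorem `SigmaLCert.stub_onLine_W0` (`Theorems/SigmaLOnLineW0.lean`: every zero of `ζ` with ordinate in
`(H₀ + 19, H₀ + 40)` is on the critical line; Riemann–Siegel interval arithmetic + Turing's method,
`native_decide`) by the RH-free `SigmaLRung.noViolationOn_of_onLine` (`Theorems/SigmaLNoViolation.lean`,
local effective Ivić theorem). References: Ivić 2003 §2 Prop. 1 (arXiv:math/0311162) [Ivic2003];
Brent 1979 Thm 3.2 [Brent1979].
-/

set_option linter.dupNamespace false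
set_option autoImplicit false

namespace Summit.RiemannHypothesis.RiemannHypothesis.Theorems.SigmaLRung

/-- **THE BC5 RUNG `SigmaL_rung_W0` (T3 witness for `SigmaL`, PROVED):** Σ_L holds on the window
`W0 = (H₀ + 20, H₀ + 30)`, `H₀ = 3 000 175 332 800`, ABOVE the Platt–Trudgian height (where RH is not
known): no positive local minimum and no negative local maximum of Hardy's `Z` there. From the certified
computation `SigmaLCert.stub_onLine_W0` by the RH-free `noViolationOn_of_onLine`. Decidable and refutable by
the same computation. Nothing here bears on the truth of RH. [cite: Ivic2003, §2 Prop. 1]; [cite: Brent1979, Thm 3.2] -/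
theorem SigmaL_rung_W0 : ∀ t : ℝ, 3000175332820 < t → t < 3000175332830 → (IsLocalMin Literature.NumberTheory.LFunctions.hardyZ t → Literature.NumberTheory.LFunctions.hardyZ t ≤ 0) ∧ (IsLocalMax Literature.NumberTheory.LFunctions.hardyZ t → 0 ≤ Literature.NumberTheory.LFunctions.hardyZ t) :=
  noViolationOn_of_onLine (A' := 3000175332819) (B' := 3000175332840)
    (by norm_num) (by norm_num) (by norm_num) SigmaLCert.stub_onLine_W0

end Summit.RiemannHypothesis.RiemannHypothesis.Theorems.SigmaLRung
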